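import Mathlib
import Literature.Analysis.FluidPDE.GaussianVortexPlanar
import Literature.Analysis.FluidPDE.GaussianVortexPlanarProofs
import Literature.Analysis.FluidPDE.BiotSavart2DSymmetry
import Literature.Analysis.FluidPDE.GaussianVortexFormDomainPoincare
import Literature.Analysis.FunctionSpaces.SmoothParametricIntegral
import HarnessLib

/-!
# The angular primitive `∂_θ⁻¹` on the plane (stub `stub_cellSolvability`, reduction step 1)

Helper file for the stub `stub_cellSolvability` of the line `braid-closed-large-circulation-gluing`
(crux stmt-AnomalousDissipation-3009, `MarginalStabilityChain.StretchedVortexRows`). The cell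
problem `Λ_G w = g` is, by `stub_cellSolvability_angularPotential` (sibling file `…Tools`), the
equation `∂_θ (Ω w + (G/2) Ψ) = g` for the cell potential; solving it starts with the MEAN-FREE
ANGULAR PRIMITIVE of the datum,
`(A g)(ξ) = ∫₀^{2π} ((σ − π)/(2π)) · g(cos σ · ξ + sin σ · ξ^⊥) dσ`
(the circle-group convolution with the sawtooth `κ(σ) = (σ − π)/(2π)`, whose Fourier multiplier is
`1/(im)` on the mode `m ≠ 0` and `0` on `m = 0`). This file proves, for smooth `g`, everything the
reduction `stub_cellSolvability_of_streamSolvability` uses about `A g`, written with the explicit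
integral (no new definition) and packaged in the registered sub-goal
`stub_cellSolvability_angularPrimitive`:

* `A g` is `C^∞` (smooth dependence of parametric integrals, tree file
  `Literature.Analysis.FunctionSpaces.SmoothParametricIntegral`), with the derivative under the
  integral sign `D(A g)(ξ)v = ∫ κ(σ) Dg(R_σ ξ)(R_σ v) dσ`;
* **`∂_θ A g = g − (circle mean)`**: `D(A g)(ξ)[ξ^⊥] = g(ξ) − (2π)⁻¹∫₀^{2π} g(R_σ ξ) dσ`
  (integration by parts on the circle: `d/dσ g(R_σ ξ) = Dg(R_σ ξ)[(R_σ ξ)^⊥]`, boundary term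
  `κ(2π)g(ξ) − κ(0)g(ξ) = g(ξ)`, bulk term the mean);
* `A g` is even when `g` is; `|A g| + |∇A g| ≤ 2πC(1+|ξ|)^k G` when `|g| + |∇g| ≤ C(1+|ξ|)^k G`
  (`|κ| ≤ ½`, `|R_σ ξ| = |ξ|`, `G` radial).

The circle-mean half (vanishing of `∫₀^{2π} g(R_σ ξ) dσ` and of the circle means of `A g` when the
circle means of `g` vanish) is the sibling file `…StubCellSolvabilityCircleMeans`.

## References

* Th. Gallay, C. E. Wayne, *Existence and stability of asymmetric Burgers vortices*, J. Math.
  Fluid Mech. 9 (2007) = arXiv:math/0503353, §3 (angular Fourier modes of `Λ`). [GallayWayne2006]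
-/

set_option linter.dupNamespace false

noncomputable section

open scoped BigOperators Topology RealInnerProductSpace ContDiff Interval
open Filter Set Function MeasureTheory WithLp intervalIntegral

namespace Summit.AnomalousDissipation.AnomalousDissipation.Theorems.MarginalStabilityChainStretchedVortexRows

open Literature.Analysis.FluidPDE Literature.Analysis.FunctionSpaces

/-! ### `ξ^⊥` as a linear map; rotations `R_σ ξ = cos σ · ξ + sin σ · ξ^⊥` -/

/-- `ξ ↦ ξ^⊥` is a continuous linear map (existence form, to avoid a definition). [folklore] -/
theorem exists_perp_clm : ∃ L : EuclideanSpace ℝ (Fin 2) →L[ℝ] EuclideanSpace ℝ (Fin 2),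
    ∀ x, L x = perp x :=
  ⟨LinearMap.toContinuousLinearMap
    { toFun := perp, map_add' := perp_add, map_smul' := perp_smul }, fun _ => rfl⟩

/-- `ξ ↦ ξ^⊥` is smooth. [folklore] -/
theorem contDiff_perp {n : WithTop ℕ∞} : ContDiff ℝ n (perp : EuclideanSpace ℝ (Fin 2) → _) := by
  obtain ⟨L, hL⟩ := exists_perp_clm
  have h : (perp : EuclideanSpace ℝ (Fin 2) → _) = ⇑L := funext fun x => (hL x).symm
  rw [h]
  exact L.contDiff

/-- `ξ ↦ ξ^⊥` is its own derivative. [folklore] -/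
theorem hasFDerivAt_perp {L : EuclideanSpace ℝ (Fin 2) →L[ℝ] EuclideanSpace ℝ (Fin 2)}
    (hL : ∀ x, L x = perp x) (x : EuclideanSpace ℝ (Fin 2)) : HasFDerivAt perp L x := by
  have h : (perp : EuclideanSpace ℝ (Fin 2) → _) = ⇑L := funext fun x => (hL x).symm
  rw [h]
  exact L.hasFDerivAt

/-- Rotations are isometries: `|cos σ · ξ + sin σ · ξ^⊥| = |ξ|`. [folklore] -/
theorem norm_rot (σ : ℝ) (ξ : EuclideanSpace ℝ (Fin 2)) :
    ‖Real.cos σ • ξ + Real.sin σ • perp ξ‖ = ‖ξ‖ := by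
  have h2 : ‖Real.cos σ • ξ + Real.sin σ • perp ξ‖ ^ 2 = ‖ξ‖ ^ 2 := by
    rw [norm_add_sq_real, norm_smul, norm_smul, real_inner_smul_left, real_inner_smul_right,
      inner_perp_self_right, norm_perp, Real.norm_eq_abs, Real.norm_eq_abs, mul_pow, mul_pow,
      sq_abs, sq_abs]
    linear_combination ‖ξ‖ ^ 2 * Real.cos_sq_add_sin_sq σ
  exact (pow_left_inj₀ (norm_nonneg _) (norm_nonneg _) two_ne_zero).1 h2

/-- `G` is rotation invariant. [folklore] -/
theorem gaussVortexProfile_rot (σ : ℝ) (ξ : EuclideanSpace ℝ (Fin 2)) :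
    gaussVortexProfile (Real.cos σ • ξ + Real.sin σ • perp ξ) = gaussVortexProfile ξ := by
  simp only [gaussVortexProfile, norm_rot]

/-- Rotations commute with `⊥`: `(R_σ ξ)^⊥ = R_σ (ξ^⊥) = cos σ · ξ^⊥ + sin σ · ξ^⊥⊥`. [folklore] -/
theorem perp_rot (σ : ℝ) (ξ : EuclideanSpace ℝ (Fin 2)) :
    perp (Real.cos σ • ξ + Real.sin σ • perp ξ) = Real.cos σ • perp ξ + Real.sin σ • perp (perp ξ) := by
  rw [perp_add, perp_smul, perp_smul]

/-- Rotations commute with the point reflection. [folklore] -/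
theorem rot_neg (σ : ℝ) (ξ : EuclideanSpace ℝ (Fin 2)) :
    Real.cos σ • (-ξ) + Real.sin σ • perp (-ξ) = -(Real.cos σ • ξ + Real.sin σ • perp ξ) := by
  rw [perp_neg, smul_neg, smul_neg, neg_add]

/-- `R_0 = id`. [folklore] -/
theorem rot_zero (ξ : EuclideanSpace ℝ (Fin 2)) : Real.cos 0 • ξ + Real.sin 0 • perp ξ = ξ := by
  simp

/-- `R_{2π} = id`. [folklore] -/
theorem rot_two_pi (ξ : EuclideanSpace ℝ (Fin 2)) :
    Real.cos (2 * Real.pi) • ξ + Real.sin (2 * Real.pi) • perp ξ = ξ := by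
  simp

/-- The orbit `σ ↦ R_σ ξ` has velocity `(R_σ ξ)^⊥`. [folklore] -/
theorem hasDerivAt_rot (ξ : EuclideanSpace ℝ (Fin 2)) (σ : ℝ) :
    HasDerivAt (fun σ : ℝ => Real.cos σ • ξ + Real.sin σ • perp ξ)
      (Real.cos σ • perp ξ + Real.sin σ • perp (perp ξ)) σ := by
  have h := ((Real.hasDerivAt_cos σ).smul_const ξ).add ((Real.hasDerivAt_sin σ).smul_const (perp ξ))
  rw [perp_perp]
  refine h.congr_deriv ?_
  rw [neg_smul, smul_neg]
  abel

/-- The rotation family `(σ, ξ) ↦ R_σ ξ` is jointly smooth. [folklore] -/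
theorem contDiff_rot_family {n : WithTop ℕ∞} :
    ContDiff ℝ n fun q : ℝ × EuclideanSpace ℝ (Fin 2) => Real.cos q.1 • q.2 + Real.sin q.1 • perp q.2 :=
  ((Real.contDiff_cos.comp contDiff_fst).smul contDiff_snd).add
    ((Real.contDiff_sin.comp contDiff_fst).smul (contDiff_perp.comp contDiff_snd))

/-- Chain rule through a fixed rotation: `D[g ∘ R_σ](ξ) v = Dg(R_σ ξ)(R_σ v)`. [folklore] -/
theorem hasFDerivAt_comp_rot {g : EuclideanSpace ℝ (Fin 2) → ℝ} {ξ : EuclideanSpace ℝ (Fin 2)}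
    (σ : ℝ) {L : EuclideanSpace ℝ (Fin 2) →L[ℝ] EuclideanSpace ℝ (Fin 2)} (hL : ∀ x, L x = perp x)
    (hg : DifferentiableAt ℝ g (Real.cos σ • ξ + Real.sin σ • perp ξ)) :
    HasFDerivAt (fun ξ : EuclideanSpace ℝ (Fin 2) => g (Real.cos σ • ξ + Real.sin σ • perp ξ))
      ((fderiv ℝ g (Real.cos σ • ξ + Real.sin σ • perp ξ)).comp
        (Real.cos σ • ContinuousLinearMap.id ℝ _ + Real.sin σ • L)) ξ := by
  have hrot : HasFDerivAt (fun ξ : EuclideanSpace ℝ (Fin 2) => Real.cos σ • ξ + Real.sin σ • perp ξ)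
      (Real.cos σ • ContinuousLinearMap.id ℝ _ + Real.sin σ • L) ξ :=
    ((hasFDerivAt_id ξ).const_smul (Real.cos σ)).add ((hasFDerivAt_perp hL ξ).const_smul (Real.sin σ))
  exact hg.hasFDerivAt.comp ξ hrot

/-! ### The sawtooth and the integrand -/

/-- The sawtooth `κ(σ) = (σ − π)/(2π)` has derivative `1/(2π)`. [folklore] -/
theorem hasDerivAt_sawtooth (σ : ℝ) :
    HasDerivAt (fun σ : ℝ => (σ - Real.pi) / (2 * Real.pi)) (1 / (2 * Real.pi)) σ :=
  ((hasDerivAt_id σ).sub_const Real.pi).div_const (2 * Real.pi)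

/-- `|κ| ≤ ½` on `(0, 2π]`. [folklore] -/
theorem abs_sawtooth_le {σ : ℝ} (hσ : σ ∈ Ι (0 : ℝ) (2 * Real.pi)) :
    |(σ - Real.pi) / (2 * Real.pi)| ≤ 1 / 2 := by
  rw [uIoc_of_le (by positivity : (0 : ℝ) ≤ 2 * Real.pi)] at hσ
  rw [abs_div, abs_of_pos (by positivity : (0 : ℝ) < 2 * Real.pi), div_le_iff₀ (by positivity)]
  have := Real.pi_pos
  rw [abs_le]
  constructor <;> nlinarith [hσ.1, hσ.2]

/-- The integrand `(σ, ξ) ↦ κ(σ) g(R_σ ξ)` of the angular primitive is jointly smooth. [folklore] -/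
theorem contDiff_primitiveIntegrand {g : EuclideanSpace ℝ (Fin 2) → ℝ} (hg : ContDiff ℝ ∞ g) :
    ContDiff ℝ ∞ fun q : ℝ × EuclideanSpace ℝ (Fin 2) =>
      (q.1 - Real.pi) / (2 * Real.pi) * g (Real.cos q.1 • q.2 + Real.sin q.1 • perp q.2) :=
  ((contDiff_fst.sub contDiff_const).div_const _).mul (hg.comp contDiff_rot_family)

/-- The partial derivative of the integrand in `ξ`, direction `v`: `κ(σ) Dg(R_σ ξ)(R_σ v)`. [folklore] -/
theorem fderiv_primitiveIntegrand_inr {g : EuclideanSpace ℝ (Fin 2) → ℝ} (hg : ContDiff ℝ ∞ g)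
    (σ : ℝ) (ξ v : EuclideanSpace ℝ (Fin 2)) :
    fderiv ℝ (fun q : ℝ × EuclideanSpace ℝ (Fin 2) =>
        (q.1 - Real.pi) / (2 * Real.pi) * g (Real.cos q.1 • q.2 + Real.sin q.1 • perp q.2))
        (σ, ξ) ((0 : ℝ), v) =
      (σ - Real.pi) / (2 * Real.pi) *
        fderiv ℝ g (Real.cos σ • ξ + Real.sin σ • perp ξ) (Real.cos σ • v + Real.sin σ • perp v) := by
  obtain ⟨L, hL⟩ := exists_perp_clm
  have h1 := hasFDerivAt_comp_prodMk (contDiff_primitiveIntegrand hg) (by simp) σ ξ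
  have hgd : DifferentiableAt ℝ g (Real.cos σ • ξ + Real.sin σ • perp ξ) :=
    (hg.differentiable (by simp)) _
  have h2 : HasFDerivAt (fun q : EuclideanSpace ℝ (Fin 2) =>
      (σ - Real.pi) / (2 * Real.pi) * g (Real.cos σ • q + Real.sin σ • perp q))
      (((σ - Real.pi) / (2 * Real.pi)) • ((fderiv ℝ g (Real.cos σ • ξ + Real.sin σ • perp ξ)).comp
        (Real.cos σ • ContinuousLinearMap.id ℝ _ + Real.sin σ • L))) ξ :=
    (hasFDerivAt_comp_rot σ hL hgd).const_mul _
  have h12 := h1.unique h2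
  have := congrArg (fun T : EuclideanSpace ℝ (Fin 2) →L[ℝ] ℝ => T v) h12
  simp only [ContinuousLinearMap.comp_apply, ContinuousLinearMap.inr_apply,
    FunLike.coe_smul, Pi.smul_apply, add_apply,
    ContinuousLinearMap.id_apply, hL, smul_eq_mul] at this
  exact this

/-! ### Smoothness and the derivative of the angular primitive -/

/-- **The angular primitive of a smooth function is smooth.** [folklore] -/
theorem contDiff_angularPrimitive {g : EuclideanSpace ℝ (Fin 2) → ℝ} (hg : ContDiff ℝ ∞ g) :
    ContDiff ℝ ∞ fun ξ : EuclideanSpace ℝ (Fin 2) => ∫ σ in (0 : ℝ)..(2 * Real.pi),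
      (σ - Real.pi) / (2 * Real.pi) * g (Real.cos σ • ξ + Real.sin σ • perp ξ) :=
  contDiff_parametric_intervalIntegral (contDiff_primitiveIntegrand hg) 0 (2 * Real.pi)

/-- **Derivative under the integral sign**: `D(A g)(ξ)v = ∫ κ(σ) Dg(R_σ ξ)(R_σ v) dσ`. [folklore] -/
theorem fderiv_angularPrimitive_apply {g : EuclideanSpace ℝ (Fin 2) → ℝ} (hg : ContDiff ℝ ∞ g)
    (ξ v : EuclideanSpace ℝ (Fin 2)) :
    fderiv ℝ (fun ξ : EuclideanSpace ℝ (Fin 2) => ∫ σ in (0 : ℝ)..(2 * Real.pi),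
        (σ - Real.pi) / (2 * Real.pi) * g (Real.cos σ • ξ + Real.sin σ • perp ξ)) ξ v =
      ∫ σ in (0 : ℝ)..(2 * Real.pi), (σ - Real.pi) / (2 * Real.pi) *
        fderiv ℝ g (Real.cos σ • ξ + Real.sin σ • perp ξ) (Real.cos σ • v + Real.sin σ • perp v) := by
  rw [fderiv_parametric_intervalIntegral_apply (contDiff_primitiveIntegrand hg) (by simp)
    0 (2 * Real.pi) ξ v]
  exact intervalIntegral.integral_congr fun σ _ => fderiv_primitiveIntegrand_inr hg σ ξ v

/-- **`∂_θ A g = g − mean`**: the angular derivative of the angular primitive returns the datum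
minus its circle mean through the point: `D(A g)(ξ)[ξ^⊥] = g(ξ) − (2π)⁻¹ ∫₀^{2π} g(R_σ ξ) dσ`
(integration by parts on the circle). [folklore] -/
theorem fderiv_angularPrimitive_perp {g : EuclideanSpace ℝ (Fin 2) → ℝ} (hg : ContDiff ℝ ∞ g)
    (ξ : EuclideanSpace ℝ (Fin 2)) :
    fderiv ℝ (fun ξ : EuclideanSpace ℝ (Fin 2) => ∫ σ in (0 : ℝ)..(2 * Real.pi),
        (σ - Real.pi) / (2 * Real.pi) * g (Real.cos σ • ξ + Real.sin σ • perp ξ)) ξ (perp ξ) =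
      g ξ - (2 * Real.pi)⁻¹ * ∫ σ in (0 : ℝ)..(2 * Real.pi),
        g (Real.cos σ • ξ + Real.sin σ • perp ξ) := by
  rw [fderiv_angularPrimitive_apply hg]
  have hgd : Differentiable ℝ g := hg.differentiable (by simp)
  -- `σ ↦ g (R_σ ξ)` and its derivative
  have hv : ∀ σ : ℝ, HasDerivAt (fun σ : ℝ => g (Real.cos σ • ξ + Real.sin σ • perp ξ))
      (fderiv ℝ g (Real.cos σ • ξ + Real.sin σ • perp ξ)
        (Real.cos σ • perp ξ + Real.sin σ • perp (perp ξ))) σ := fun σ =>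
    (hgd _).hasFDerivAt.comp_hasDerivAt σ (hasDerivAt_rot ξ σ)
  have hcont_rot : Continuous fun σ : ℝ => Real.cos σ • ξ + Real.sin σ • perp ξ :=
    (Real.continuous_cos.smul continuous_const).add (Real.continuous_sin.smul continuous_const)
  have hv'c : Continuous fun σ : ℝ => fderiv ℝ g (Real.cos σ • ξ + Real.sin σ • perp ξ)
      (Real.cos σ • perp ξ + Real.sin σ • perp (perp ξ)) :=
    ((hg.continuous_fderiv (by simp)).comp hcont_rot).clm_apply
      ((Real.continuous_cos.smul continuous_const).add (Real.continuous_sin.smul continuous_const))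
  have hibp := intervalIntegral.integral_mul_deriv_eq_deriv_mul (a := (0 : ℝ)) (b := 2 * Real.pi)
    (fun σ _ => hasDerivAt_sawtooth σ) (fun σ _ => hv σ)
    (continuous_const.intervalIntegrable _ _) (hv'c.intervalIntegrable _ _)
  simp_rw [← perp_rot] at hibp ⊢
  rw [hibp, rot_two_pi, rot_zero, intervalIntegral.integral_const_mul]
  have hπ : Real.pi ≠ 0 := Real.pi_ne_zero
  field_simp
  ring

/-! ### Symmetry and size -/

/-- The angular primitive of an even function is even. [folklore] -/
theorem angularPrimitive_neg {g : EuclideanSpace ℝ (Fin 2) → ℝ} (hg : ∀ ξ, g (-ξ) = g ξ)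
    (ξ : EuclideanSpace ℝ (Fin 2)) :
    (∫ σ in (0 : ℝ)..(2 * Real.pi), (σ - Real.pi) / (2 * Real.pi) *
        g (Real.cos σ • (-ξ) + Real.sin σ • perp (-ξ))) =
      ∫ σ in (0 : ℝ)..(2 * Real.pi), (σ - Real.pi) / (2 * Real.pi) *
        g (Real.cos σ • ξ + Real.sin σ • perp ξ) := by
  refine intervalIntegral.integral_congr fun σ _ => ?_
  simp only [rot_neg, hg]

/-- **Weighted bounds for the angular primitive**: if `|g| + |∇g| ≤ C(1+|ξ|)^k G` then
`|A g| + |∇A g| ≤ 2πC(1+|ξ|)^k G` (`|κ| ≤ ½`, rotations preserve `|ξ|` and `G`). [folklore] -/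
theorem angularPrimitive_bound {g : EuclideanSpace ℝ (Fin 2) → ℝ} (hg : ContDiff ℝ ∞ g) {k : ℕ}
    {C : ℝ} (hb : ∀ ξ, |g ξ| + ‖gradient g ξ‖ ≤ C * (1 + ‖ξ‖) ^ k * gaussVortexProfile ξ)
    (ξ : EuclideanSpace ℝ (Fin 2)) :
    |∫ σ in (0 : ℝ)..(2 * Real.pi), (σ - Real.pi) / (2 * Real.pi) *
        g (Real.cos σ • ξ + Real.sin σ • perp ξ)| +
      ‖gradient (fun ξ : EuclideanSpace ℝ (Fin 2) => ∫ σ in (0 : ℝ)..(2 * Real.pi),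
        (σ - Real.pi) / (2 * Real.pi) * g (Real.cos σ • ξ + Real.sin σ • perp ξ)) ξ‖ ≤
      2 * Real.pi * C * (1 + ‖ξ‖) ^ k * gaussVortexProfile ξ := by
  set B : ℝ := C * (1 + ‖ξ‖) ^ k * gaussVortexProfile ξ with hB
  have hB0 : 0 ≤ B := le_trans (by positivity) (hb ξ)
  have hgval : ∀ σ, |g (Real.cos σ • ξ + Real.sin σ • perp ξ)| ≤ B := fun σ => by
    have h := hb (Real.cos σ • ξ + Real.sin σ • perp ξ)
    rw [norm_rot, gaussVortexProfile_rot] at h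
    exact le_trans (le_add_of_nonneg_right (norm_nonneg _)) h
  have hgder : ∀ σ (v : EuclideanSpace ℝ (Fin 2)),
      |fderiv ℝ g (Real.cos σ • ξ + Real.sin σ • perp ξ) (Real.cos σ • v + Real.sin σ • perp v)| ≤
        B * ‖v‖ := fun σ v => by
    have h := hb (Real.cos σ • ξ + Real.sin σ • perp ξ)
    rw [norm_rot, gaussVortexProfile_rot, norm_gradient_eq_norm_fderiv_fin_two] at h
    have h' : ‖fderiv ℝ g (Real.cos σ • ξ + Real.sin σ • perp ξ)‖ ≤ B :=
      le_trans (le_add_of_nonneg_left (abs_nonneg _)) h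
    calc |fderiv ℝ g (Real.cos σ • ξ + Real.sin σ • perp ξ) (Real.cos σ • v + Real.sin σ • perp v)|
        ≤ ‖fderiv ℝ g (Real.cos σ • ξ + Real.sin σ • perp ξ)‖ * ‖Real.cos σ • v + Real.sin σ • perp v‖ :=
          by rw [← Real.norm_eq_abs]; exact ContinuousLinearMap.le_opNorm _ _
      _ ≤ B * ‖v‖ := by rw [norm_rot]; gcongr
  -- the value
  have h1 : |∫ σ in (0 : ℝ)..(2 * Real.pi), (σ - Real.pi) / (2 * Real.pi) *
      g (Real.cos σ • ξ + Real.sin σ • perp ξ)| ≤ 1 / 2 * B * |2 * Real.pi - 0| := by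
    rw [← Real.norm_eq_abs]
    refine intervalIntegral.norm_integral_le_of_norm_le_const fun σ hσ => ?_
    rw [Real.norm_eq_abs, abs_mul]
    exact mul_le_mul (abs_sawtooth_le hσ) (hgval σ) (abs_nonneg _) (by norm_num)
  -- the gradient
  have h2 : ‖gradient (fun ξ : EuclideanSpace ℝ (Fin 2) => ∫ σ in (0 : ℝ)..(2 * Real.pi),
      (σ - Real.pi) / (2 * Real.pi) * g (Real.cos σ • ξ + Real.sin σ • perp ξ)) ξ‖ ≤
      1 / 2 * B * |2 * Real.pi - 0| := by
    rw [norm_gradient_eq_norm_fderiv_fin_two]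
    refine ContinuousLinearMap.opNorm_le_bound _ (by positivity) fun v => ?_
    rw [fderiv_angularPrimitive_apply hg, Real.norm_eq_abs, ← Real.norm_eq_abs]
    have : 1 / 2 * B * |2 * Real.pi - 0| * ‖v‖ = 1 / 2 * (B * ‖v‖) * |2 * Real.pi - 0| := by ring
    rw [this]
    refine intervalIntegral.norm_integral_le_of_norm_le_const fun σ hσ => ?_
    rw [Real.norm_eq_abs, abs_mul]
    exact mul_le_mul (abs_sawtooth_le hσ) (hgder σ v) (abs_nonneg _) (by norm_num)
  have hπ : |2 * Real.pi - 0| = 2 * Real.pi := by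
    rw [sub_zero, abs_of_pos (by positivity)]
  rw [hπ] at h1 h2
  calc _ ≤ 1 / 2 * B * (2 * Real.pi) + 1 / 2 * B * (2 * Real.pi) := add_le_add h1 h2
    _ = 2 * Real.pi * C * (1 + ‖ξ‖) ^ k * gaussVortexProfile ξ := by rw [hB]; ring

/-! ### The registered package -/

/-- **The angular primitive `∂_θ⁻¹`, calculus part** (registered on stmt-AnomalousDissipation-3009
as the sub-goal `stub_cellSolvability_angularPrimitive`; step 1 of the reduction
`stub_cellSolvability_of_streamSolvability`). For smooth `g`, the explicit integral
`(A g)(ξ) = ∫₀^{2π} ((σ − π)/(2π)) g(cos σ·ξ + sin σ·ξ^⊥) dσ` is smooth; its angular derivative is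
`D(A g)(ξ)[ξ^⊥] = g(ξ) − (2π)⁻¹ ∫₀^{2π} g(R_σ ξ) dσ`; it is even when `g` is; and it obeys
`|A g| + |∇A g| ≤ 2πC(1+|ξ|)^k G` whenever `|g| + |∇g| ≤ C(1+|ξ|)^k G`. [folklore] -/
theorem stub_cellSolvability_angularPrimitive : ∀ g : EuclideanSpace ℝ (Fin 2) → ℝ, ContDiff ℝ ∞ g →
    ContDiff ℝ ∞ (fun ξ : EuclideanSpace ℝ (Fin 2) => ∫ σ in (0 : ℝ)..(2 * Real.pi),
      (σ - Real.pi) / (2 * Real.pi) * g (Real.cos σ • ξ + Real.sin σ • perp ξ)) ∧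
    (∀ ξ : EuclideanSpace ℝ (Fin 2),
      fderiv ℝ (fun ξ : EuclideanSpace ℝ (Fin 2) => ∫ σ in (0 : ℝ)..(2 * Real.pi),
        (σ - Real.pi) / (2 * Real.pi) * g (Real.cos σ • ξ + Real.sin σ • perp ξ)) ξ (perp ξ) =
      g ξ - (2 * Real.pi)⁻¹ * ∫ σ in (0 : ℝ)..(2 * Real.pi),
        g (Real.cos σ • ξ + Real.sin σ • perp ξ)) ∧
    ((∀ ξ, g (-ξ) = g ξ) → ∀ ξ : EuclideanSpace ℝ (Fin 2),
      (∫ σ in (0 : ℝ)..(2 * Real.pi), (σ - Real.pi) / (2 * Real.pi) *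
        g (Real.cos σ • (-ξ) + Real.sin σ • perp (-ξ))) =
      ∫ σ in (0 : ℝ)..(2 * Real.pi), (σ - Real.pi) / (2 * Real.pi) *
        g (Real.cos σ • ξ + Real.sin σ • perp ξ)) ∧
    (∀ (k : ℕ) (C : ℝ), (∀ ξ, |g ξ| + ‖gradient g ξ‖ ≤ C * (1 + ‖ξ‖) ^ k * gaussVortexProfile ξ) →
      ∀ ξ : EuclideanSpace ℝ (Fin 2),
        |∫ σ in (0 : ℝ)..(2 * Real.pi), (σ - Real.pi) / (2 * Real.pi) *
            g (Real.cos σ • ξ + Real.sin σ • perp ξ)| +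
          ‖gradient (fun ξ : EuclideanSpace ℝ (Fin 2) => ∫ σ in (0 : ℝ)..(2 * Real.pi),
            (σ - Real.pi) / (2 * Real.pi) * g (Real.cos σ • ξ + Real.sin σ • perp ξ)) ξ‖ ≤
        2 * Real.pi * C * (1 + ‖ξ‖) ^ k * gaussVortexProfile ξ) := by
  intro g hg
  exact ⟨contDiff_angularPrimitive hg, fderiv_angularPrimitive_perp hg,
    fun he ξ => angularPrimitive_neg he ξ, fun k C hb ξ => angularPrimitive_bound hg hb ξ⟩

end Summit.AnomalousDissipation.AnomalousDissipation.Theorems.MarginalStabilityChainStretchedVortexRows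

end
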